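import Summits.Ventures.PercRepro.LemmaBPlusK5Def

/-!
# Faces of `K₅`: kernel slices 24 … 27 (part G)

Each theorem is one `decide +kernel` at default heartbeats (≈ 55 s: the 1024-row table of the marking
plus ≤ 22 000 face points in sub-mask loops); generated by `tools/gen_k5.py`.
-/

namespace PercRepro

namespace Examples

open MultiGraph

/-- Slice 24: joins `u ∈ [827, 851)` of the faces of `K₅` (21330 face points). -/
theorem k5_slice_24 : k5.FacesSRange ![0, 1, 2, 3] 827 851 := by decide +kernel

/-- Slice 25: joins `u ∈ [851, 869)` of the faces of `K₅` (21708 face points). -/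
theorem k5_slice_25 : k5.FacesSRange ![0, 1, 2, 3] 851 869 := by decide +kernel

/-- Slice 26: joins `u ∈ [869, 883)` of the faces of `K₅` (20898 face points). -/
theorem k5_slice_26 : k5.FacesSRange ![0, 1, 2, 3] 869 883 := by decide +kernel

/-- Slice 27: joins `u ∈ [883, 891)` of the faces of `K₅` (18954 face points). -/
theorem k5_slice_27 : k5.FacesSRange ![0, 1, 2, 3] 883 891 := by decide +kernel

end Examples

end PercRepro
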